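import Literature.AlgebraicGeometry.Resolution.QuadraticSequencePrincipalGeneratorAbhyankar
import Mathlib.RingTheory.Valuation.LocalSubring
import HarnessLib

/-!
# Along ANY infinite sequence of successive quadratic transforms of a two-dimensional regular local ring,
# finitely generated ideals become principal — no valuation and no dominating Noetherian ring in the hypotheses

Topic: `Literature/AlgebraicGeometry/Resolution`. PROVED, fact-free, definition-free (hand
leafhand-res-homologicalconduct-16 g2 of the cell decomp-res; AI-written, weaker than expert review).

Zariski's finiteness argument (Lipman 1969, proof of Theorem (26.2), p. 274; Abhyankar 1956, Lemma 12) needs a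
valuation dominating the whole infinite sequence `R 0 < R 1 < ⋯` of quadratic transforms.  Such a valuation
always exists: the union `⋃ R n` is a local subring of `K` (the inclusions are local), and every local subring of a
field is dominated by a valuation ring (Chevalley; Mathlib `LocalSubring.exists_le_valuationSubring`, Stacks 00IA);
a quadratic transform dominated by `O` IS the quadratic transform along `O` (tree `IsQuadraticTransform.along`),
the transforms stay regular (tree `IsQuadraticTransformAlong.isRegularLocalRing_of_isRegularLocalRing`), and then
`exists_principal_generator_of_quadraticSequenceAlong` (Abhyankar's union lemma + the divisibility engine) applies:

* `exists_valuationSubring_subringDominates_of_chain` — a chain `R 0 ≤ R 1 ≤ ⋯` of local subrings of `K`, each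
  dominated by the next, is dominated termwise by one valuation ring of `K`;
* `isQuadraticTransformAlong_of_chain` — a sequence of quadratic transforms starting from a regular (Noetherian)
  local ring and dominated termwise by a valuation ring `O` is the sequence of quadratic transforms ALONG `O`, and all
  its members are regular local rings;
* `exists_principal_generator_of_quadraticSequence'` — **along every infinite sequence of successive quadratic
  transforms of a two-dimensional regular local ring `R 0` of `K` (`Frac (R 0) = K`), every finite `T ⊆ R 0` with a
  non-zero member generates, in some `R n`, the principal ideal `a · R n` of one of its members `a ∈ T`.**

Use: the termination of point-blow-up principalization on regular surfaces (tree `PrincipalizationFromNoInfiniteRun.lean`,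
hypothesis «no infinite run»; `Lipman1969_1_2_B_of_principalization_finite`) — what is left there is only the
scheme ↔ ring dictionary identifying the local rings of an infinite thread of infinitely-near bad points with such a
sequence (`BlowupStalkQuadraticTransform.lean`) and the extraction of the thread.  No summit statement is proved.

## References
* J. Lipman, Publ. Math. IHÉS 36 (1969), Theorem (26.2) and its proof (p. 274). [Lipman1969]
* S. S. Abhyankar, Amer. J. Math. 78 (1956), Lemma 12; S. D. Cutkosky, Math. Ann. 362 (2015), Lemma 2.2.
  [Abhyankar1956Valuations] [Cutkosky2014]
* The Stacks Project, Tag 00IA (local rings are dominated by valuation rings). [StacksProject]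
-/

noncomputable section

namespace Literature.AlgebraicGeometry.Resolution

universe u

open IsLocalRing

variable {K : Type u} [Field K]

/-- **A chain of local subrings of a field, each dominated by the next, is dominated by a valuation ring**
(Chevalley / Stacks 00IA applied to the union, which is a local subring). [cite: StacksProject, Tag 00IA] -/
theorem exists_valuationSubring_subringDominates_of_chain (R : ℕ → Subring K) (hloc : ∀ n, IsLocalRing (R n))
    (hdom : ∀ n, SubringDominates (R n) (R (n + 1))) :
    ∃ O : ValuationSubring K, ∀ n, SubringDominates (R n) O.toSubring := by
  have hmono : Monotone R := monotone_nat_of_le_succ fun n => (hdom n).1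
  -- domination along the chain
  have hdom' : ∀ {m n}, m ≤ n → SubringDominates (R m) (R n) := by
    intro m n hmn
    induction hmn with
    | refl => exact SubringDominates.refl _
    | step _ ih => exact ih.trans (hdom _)
  -- the union
  set U : Subring K := ⨆ n, R n with hU
  have hdir : Directed (· ≤ ·) R := hmono.directed_le
  have hmemU : ∀ {x : K}, x ∈ U ↔ ∃ n, x ∈ R n := fun {x} => Subring.mem_iSup_of_directed hdir
  have hRU : ∀ n, R n ≤ U := fun n => le_iSup R n
  -- an element of `R n` with inverse in `U` has its inverse in `R n`
  have hinv : ∀ n, ∀ x ∈ R n, x⁻¹ ∈ U → x⁻¹ ∈ R n := by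
    intro n x hx hxU
    obtain ⟨m, hm⟩ := hmemU.mp hxU
    exact (hdom' (le_max_left n m)).2 x hx (hmono (le_max_right n m) hm)
  -- `U` is local
  haveI : IsLocalRing U := by
    refine IsLocalRing.of_nonunits_add ?_
    intro a b ha hb hab
    obtain ⟨n, hn⟩ := hmemU.mp a.2
    obtain ⟨m, hm⟩ := hmemU.mp b.2
    set N := max n m
    have haN : (a : K) ∈ R N := hmono (le_max_left n m) hn
    have hbN : (b : K) ∈ R N := hmono (le_max_right n m) hm
    haveI := hloc N
    -- `a + b` is a unit of `R N`
    have hu : IsUnit (⟨(a : K) + b, (R N).add_mem haN hbN⟩ : R N) := by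
      obtain ⟨h0, hi⟩ := (isUnit_subring_iff_inv_mem (R := U) (a + b)).mp hab
      exact (isUnit_subring_iff_inv_mem _).mpr ⟨h0, hinv N _ ((R N).add_mem haN hbN) hi⟩
    -- hence `a` or `b` is a unit of `R N`, hence of `U`
    rcases IsLocalRing.isUnit_or_isUnit_of_isUnit_add
        (show IsUnit ((⟨(a : K), haN⟩ : R N) + ⟨(b : K), hbN⟩) from hu) with h | h
    · obtain ⟨h0, hi⟩ := (isUnit_subring_iff_inv_mem _).mp h
      exact ha ((isUnit_subring_iff_inv_mem (R := U) a).mpr ⟨h0, hRU N hi⟩)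
    · obtain ⟨h0, hi⟩ := (isUnit_subring_iff_inv_mem _).mp h
      exact hb ((isUnit_subring_iff_inv_mem (R := U) b).mpr ⟨h0, hRU N hi⟩)
  -- a valuation ring dominating `U`
  obtain ⟨O, hO⟩ := (LocalSubring.mk U).exists_le_valuationSubring
  have hUO : SubringDominates U O.toSubring := by
    haveI : IsLocalRing O.toSubring := inferInstanceAs (IsLocalRing O)
    exact (subringDominates_iff U O.toSubring).mpr hO
  refine ⟨O, fun n => ?_⟩
  haveI := hloc n
  exact SubringDominates.trans ⟨hRU n, hinv n⟩ hUO

/-- **A sequence of quadratic transforms dominated by a valuation ring `O` is the sequence along `O`, and stays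
regular.**  `R 0` a regular local ring of `K`, `R (i+1)` a quadratic transform of `R i`, every `R i` dominated by
`O`: then every `R i` is a regular local ring and `R (i+1)` is the quadratic transform of `R i` ALONG `O`
(tree `IsQuadraticTransform.along` — the maximal ideals are finitely generated by regularity — and
`IsQuadraticTransformAlong.isRegularLocalRing_of_isRegularLocalRing`). [cite: Cutkosky2014, §2.2]
[cite: Abhyankar1956Valuations, Prop. 8] -/
theorem isQuadraticTransformAlong_of_chain (O : ValuationSubring K) (R : ℕ → Subring K)
    (hreg : IsRegularLocalRing (R 0)) (hqt : ∀ i, IsQuadraticTransform (R i) (R (i + 1)))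
    (hdomO : ∀ i, SubringDominates (R i) O.toSubring) (i : ℕ) :
    IsRegularLocalRing (R i) ∧ IsQuadraticTransformAlong O (R i) (R (i + 1)) := by
  induction i with
  | zero =>
    haveI := hreg
    exact ⟨hreg, (hqt 0).along ⟨inferInstance, IsNoetherian.noetherian _⟩ (hdomO 1)⟩
  | succ i ih =>
    have hreg' : IsRegularLocalRing (R (i + 1)) := ih.2.isRegularLocalRing_of_isRegularLocalRing ih.1
    haveI := hreg'
    exact ⟨hreg', (hqt (i + 1)).along ⟨inferInstance, IsNoetherian.noetherian _⟩ (hdomO (i + 2))⟩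

/-- **Zariski–Abhyankar termination, hypothesis-free form.**  Along every infinite sequence `R 0 → R 1 → ⋯` of
successive quadratic transforms of a two-dimensional regular local ring `R 0` of the field `K` (`Frac (R 0) = K`),
every finite set `T ⊆ R 0` with a non-zero member generates, in some `R n`, the PRINCIPAL ideal `a · R n` of one
of its members `a ∈ T`, `a ≠ 0` (and `T ⊆ R n`).  Proof: a valuation ring dominating the union
(`exists_valuationSubring_subringDominates_of_chain`), the sequence is the one along it (`isQuadraticTransformAlong_of_chain`),
and `exists_principal_generator_of_quadraticSequenceAlong` (Abhyankar's union lemma + divisibility).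
[cite: Lipman1969, Theorem (26.2), proof (p. 274)] [cite: Abhyankar1956Valuations, Lemma 12] -/
theorem exists_principal_generator_of_quadraticSequence' (R : ℕ → Subring K)
    (hreg : IsRegularLocalRing (R 0)) (hdim : ringKrullDim (R 0) = 2) (hof : IsLocalRingOf (R 0))
    (hqt : ∀ i, IsQuadraticTransform (R i) (R (i + 1)))
    (T : Finset K) (hT : ∀ t ∈ T, t ∈ R 0) (hne : ∃ t ∈ T, t ≠ 0) :
    ∃ n, ∃ a ∈ T, a ≠ 0 ∧ (∀ t ∈ T, t ∈ R n) ∧ ∀ t ∈ T, ∃ r ∈ R n, t = a * r := by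
  haveI : IsLocalRing (R 0) := inferInstance
  have hloc : ∀ n, IsLocalRing (R n) := fun n => by
    cases n with
    | zero => infer_instance
    | succ k => exact (hqt k).isLocalRing
  obtain ⟨O, hO⟩ := exists_valuationSubring_subringDominates_of_chain R hloc (fun n => (hqt n).dominates)
  exact exists_principal_generator_of_quadraticSequenceAlong O R hreg hdim hof (hO 0)
    (fun i => (isQuadraticTransformAlong_of_chain O R hreg hqt hO i).2) T hT hne

end Literature.AlgebraicGeometry.Resolution

end
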